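/-
Copyright: the b2b-balaban T⁴-continuum CRUX team, row NE7b OWNER lineage `t4-ne7b-p1` (gen 130). Project licence.
-/
import Summits.QuantumFields.BalabanUV.T4Continuum.Spine.NE7b.SupTiltedCovarianceDecay
import Summits.QuantumFields.BalabanUV.T4Continuum.Spine.NE7b.SupEffectiveActionCovariance
import Summits.QuantumFields.BalabanUV.T4Continuum.Spine.NE7b.SupEffectiveActionGradientSmall

/-!
# THE NEXT HESSIAN IS LOCAL UP TO EXPONENTIALLY SMALL TAILS: for the small-field step on the road with `C²` remainders `w` (`|w| ≤ c₃|t|³` on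
# `|t| ≤ h`, `|w′| ≤ κ₁|t|` and `≤ c₂t²`, `|w″| ≤ κ₂`, stability `κ₀`), two sites `y ∈ cell p₀`, `z ∈ cell p₁` of `S` that are `n + 1` cells apart
# in a potential `d`, and the small block field `ψ₀`,
#   `|D²(−log Z_·(S))(ψ₀)(e_y, e_z)| = |Cov_ν(w′_y, w′_z)| ≤ (4(Δ+1)2e^{1+η}ε̃_ΨA_τ^v + M₂ + M₃∕2)·e^{−η(n+1)∕4}`
# uniformly in the volume — the off-diagonal entries of the next quadratic form decay exponentially in the block distance: (320)'s covariance
# formula for the Hessian at the directions `e_y, e_z` (the `w″` term is diagonal, the gradient sums pick the sites) and (332c)'s decay of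
# correlations with the one-site quadratic observables `F = G = w′` (row NE7b, node U5c; (319)∕(320)∕(315)∕(332c) BY NAME; [folklore])

Cell `pub-balaban`, sub-cell `t4`, spine estimate NE7b (`T4WeightBudget.RelWeightBound`; the cell's OWN estimate — NOT PRINTED in
[Bałaban 1983–89], NOT PROVED).  Crux-route work under `Spine/NE7b/` by the row OWNER (`t4-ne7b-p1` gen 130, file (333)) under FREEZE
(0)'s crux-prover clause, on § [NE7bP1-G129-HANDOFF] NEXT (i)∕(ii) (SCOPING-d4: locality of the next Hessian); NOTHING of Bałaban's is named as
a Lean object, valued or asserted; no `T4Continuum/Support` leaf typed; no `def`, no notation; zero `sorry`.  Imports (BY NAME): the OWNER's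
(332c) `…SupTiltedCovarianceDecay` (`abs_tilted_cov_decay`), (320) `…SupEffectiveActionCovariance` (`hessian_neg_log_step_apply`), (319)
(`hasFDerivAt_fderiv_neg_log_step`), (315) `…SupEffectiveActionGradientSmall` (`single_cellSum`), (313) (`mul_opBound_le_of_le`), (297).

WHAT IS PROVED ([folklore]): §1 `single_single_cellSum_eq_zero` (`Σ_pΣ_x w″_x·(e_y)_x(e_z)_x = 0` for `y ≠ z`), `cov_rearrange`
(`Z⁻¹(−I_AB) + Z⁻²I_AI_B = −((I_AB·Z − I_A·I_B)∕Z²)`); §2 THE END **`abs_hessian_offDiag_le`**; §3 toy.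

HONEST (what this is NOT).  Off-diagonal entries between sites of DIFFERENT, separated cells only (the diagonal and near entries are (322)'s
`(4λ_w+Λ_w)`-letter); constants explicit but unoptimised; the price of the moments is `δ₀ > 0` of stability room and the quadratic letter
`|w′| ≤ c₂t²`; small-field step only; scalar skeleton ((A3), NC-NE7b-α UNRULED); nothing of Bałaban's asserted.  BY-NAME EFFECT ON THE WALL:
NONE.  NE7b NOT PRINTED ∕ NOT PROVED; spine PROVED 0∕9; rung (B)+1 — the programme's measures remain FINITE-torus statements; NOT the mass gap,
NOT Clay.  HONEST DEPENDENCY: continuum YM on T⁴ ⇐ BetaPertH ∧ nine spine estimates (0∕9 proved); BetaPertH ⇐ (D1) ∧ (D4) ∧ CAP+tail; G-an2-4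
gates asym, D1 and NE2∕3∕4.
-/

set_option autoImplicit false

noncomputable section

namespace Summit.QuantumFields.BalabanUV.T4Continuum.NE7b.SupNextHessianLocality

open MeasureTheory ProbabilityTheory Finset Real
open scoped BigOperators
open Literature.Analysis.Matrix (HasFiniteRange)
open SupTiltedCovarianceDecay (abs_tilted_cov_decay)
open SupEffectiveActionCovariance (hessian_neg_log_step_apply)
open SupEffectiveActionHessian (hasFDerivAt_fderiv_neg_log_step)
open SupEffectiveActionGradientSmall (single_cellSum)
open SupEffectiveActionDerivative (mul_opBound_le_of_le)
open SupSmallFieldGasReal (cellSum_eq_sum_biUnion)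
open SupFluctuationAPriori (integrable_exp_neg)

set_option maxSynthPendingDepth 2

variable {ι : Type} [Fintype ι] [DecidableEq ι] {V : Type*} [DecidableEq V]

/-! ## §1. Bookkeeping -/

omit [Fintype ι] [DecidableEq V] in
/-- **The `w″` term is diagonal**: `y ≠ z` ⟹ `Σ_{p∈S}Σ_{x∈cell p}w″_x(ω_x+ψ_x)·(e_y)_x·(e_z)_x = 0`. [folklore] -/
theorem single_single_cellSum_eq_zero {cell : V → Finset ι} {w'' : ι → ℝ → ℝ} (S : Finset V) {y z : ι} (hyz : y ≠ z)
    (ω ψ : EuclideanSpace ℝ ι) :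
    ∑ p ∈ S, ∑ x ∈ cell p, w'' x (ω x + ψ x) * (EuclideanSpace.single y (1 : ℝ)) x * (EuclideanSpace.single z (1 : ℝ)) x = 0 := by
  refine sum_eq_zero fun p _ => sum_eq_zero fun x _ => ?_
  simp_rw [EuclideanSpace.single, PiLp.single_apply]
  by_cases hx : x = y
  · subst hx
    simp [hyz]
  · simp [hx]

/-- `Z ≠ 0` ⟹ `Z⁻¹·(−I_AB) + (Z²)⁻¹·(I_A·I_B) = −((I_AB·Z − I_A·I_B)∕Z²)`. [folklore] -/
theorem cov_rearrange {Z IA IB IAB : ℝ} (hZ : Z ≠ 0) : Z⁻¹ * -IAB + (Z ^ 2)⁻¹ * (IA * IB) = -((IAB * Z - IA * IB) / Z ^ 2) := by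
  field_simp
  ring

/-! ## §2. THE END: the off-diagonal Hessian decays -/

section Main

variable {Γ : Matrix ι ι ℝ} {γop γ : ℝ} {dι : ι → ι → ℕ} {ρ : ℕ} {cell : V → Finset ι} {v : ℕ} {R : V → V → Prop}
  [DecidableRel R] [Std.Symm R] {nbr : V → Finset V} {Δ : ℕ} {w w' w'' : ι → ℝ → ℝ} {κ₀ κ₁ κ₂ c₂ c₃ h κ τ θ Ψ δ₀ η : ℝ}

/-- **THE END — THE NEXT HESSIAN IS EXPONENTIALLY LOCAL.**  Road data with `C²` remainders (`HasDerivAt` letters for `w, w′`, measurable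
`w′, w″`, `−κ₀u² ≤ w`, `|w| ≤ c₃|u|³` on `|u| ≤ h`, `|w′| ≤ κ₁|u|`, `|w′| ≤ c₂u²`, `|w″| ≤ κ₂`); `0 < δ₀`, `2(κ₀+2c₂+δ₀) ≤ κ`,
`κ(1+τ)γ_op ≤ θ`, `2(κ₀+8c₂)(1+τ)γ_op ≤ θ < 1`; `ψ₀` small on the cells of `S`; `y ∈ cell p₀`, `z ∈ cell p₁`, `p₀, p₁ ∈ S`; a potential `d`
with `d p₀ = 0`, `n + 2 ≤ d p₁`; KP smallness with room `e^{1+η}` and for the `δ₀`-perturbed family; `M_road ≤ M` ⟹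
`|D²(−log Z_·(S))(ψ₀)(e_y)(e_z)| ≤ (4(Δ+1)2e^{1+η}ε̃_ΨA_τ^v + M₂ + M₃∕2)·e^{−η(n+1)∕4}`,
`M₂ = 2c₂²δ₀⁻²M + (c₂δ₀⁻¹M)²`, `M₃ = 6c₂³δ₀⁻³M + 6c₂³δ₀⁻³M² + 2c₂³δ₀⁻³M³`. [folklore] -/
theorem abs_hessian_offDiag_le (hΓ : Γ.PosSemidef) (hΓop : (γop • (1 : Matrix ι ι ℝ) - Γ).PosSemidef) (hdiag : ∀ i, Γ i i ≤ γ) (hγ : 0 ≤ γ)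
    (hfr : HasFiniteRange dι ρ Γ) (hdisj : ∀ p q, p ≠ q → Disjoint (cell p) (cell q)) (hv : ∀ p, (cell p).card ≤ v)
    (hR : ∀ (p p' : V) (x y : ι), x ∈ cell p → y ∈ cell p' → dι x y ≤ ρ → p = p' ∨ R p p') (hΔ : ∀ x, (nbr x).card ≤ Δ)
    (hnbr : ∀ x y, R x y → y ∈ nbr x) (hw' : ∀ x t, HasDerivAt (w x) (w' x t) t) (hw'' : ∀ x t, HasDerivAt (w' x) (w'' x t) t)
    (hw'm : ∀ x, Measurable (w' x)) (hw''m : ∀ x, Measurable (w'' x)) (hκ₀ : 0 ≤ κ₀) (hκ₁ : 0 ≤ κ₁) (hc₂ : 0 ≤ c₂) (hc₃ : 0 ≤ c₃) (hh : 0 ≤ h)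
    (hδ₀ : 0 < δ₀) (hstab : ∀ x, ∀ u : ℝ, -(κ₀ * u ^ 2) ≤ w x u) (hcub : ∀ x, ∀ u : ℝ, |u| ≤ h → |w x u| ≤ c₃ * |u| ^ 3)
    (hw'b : ∀ x u, |w' x u| ≤ κ₁ * |u|) (hw'q : ∀ x u, |w' x u| ≤ c₂ * u ^ 2) (hw''b : ∀ x u, |w'' x u| ≤ κ₂) (hκ : 2 * ((κ₀ + 2 * c₂) + δ₀) ≤ κ)
    (hτ : 0 < τ) (hθ0 : 0 < θ) (hθ1 : θ < 1) (hκθ : κ * (1 + τ) * γop ≤ θ) (hκθ₈ : 2 * (κ₀ + 2 * (4 * c₂)) * (1 + τ) * γop ≤ θ) (S : Finset V)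
    (ψ₀ : EuclideanSpace ℝ ι) (hψ : ∀ p ∈ S, ∑ x ∈ cell p, ψ₀ x ^ 2 ≤ Ψ ^ 2) {p₀ p₁ : V} (hp₀ : p₀ ∈ S) (hp₁ : p₁ ∈ S) {y z : ι} (hy : y ∈ cell p₀)
    (hz : z ∈ cell p₁) {d : V → ℕ} (hd : ∀ p q, R p q → d q ≤ d p + 1) {n : ℕ} (hd₀ : d p₀ = 0) (hd₁ : n + 2 ≤ d p₁) (hη : 0 ≤ η)
    (hsmall₂ : Real.exp (1 + η) * (((max (exp (v * (c₃ * h ^ 3 + 2 * c₂ * h ^ 2)) - 1) (2 * exp (-((κ / 2 - (κ₀ + 2 * c₂)) * h ^ 2)))) *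
      exp (κ * (1 + τ⁻¹) * Ψ ^ 2 / 2)) * ((1 - θ) ^ (-(κ * (1 + τ) * γ / (2 * θ)))) ^ v) * ((Δ : ℝ) + 1) ^ 2 ≤ 1 / 2)
    (hsmall : Real.exp 1 * (((max (exp (v * ((c₃ * h ^ 3 + 2 * c₂ * h ^ 2) + δ₀ * h ^ 2)) - 1)
      (2 * exp (-((κ / 2 - ((κ₀ + 2 * c₂) + δ₀)) * h ^ 2)))) * exp (κ * (1 + τ⁻¹) * Ψ ^ 2 / 2)) *
      ((1 - θ) ^ (-(κ * (1 + τ) * γ / (2 * θ)))) ^ v) * ((Δ : ℝ) + 1) ^ 2 ≤ 1 / 2) {M : ℝ}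
    (hM : exp (2 * ((1 : ℝ) * ((Δ : ℝ) + 1) * (2 * (Real.exp 1 *
        (((max (exp (v * ((c₃ * h ^ 3 + 2 * c₂ * h ^ 2) + δ₀ * h ^ 2)) - 1) (2 * exp (-((κ / 2 - ((κ₀ + 2 * c₂) + δ₀)) * h ^ 2)))) *
          exp (κ * (1 + τ⁻¹) * Ψ ^ 2 / 2)) * ((1 - θ) ^ (-(κ * (1 + τ) * γ / (2 * θ)))) ^ v))))) ≤ M) :
    |(fderiv ℝ (fun ψ : EuclideanSpace ℝ ι => fderiv ℝ (fun φ : EuclideanSpace ℝ ι =>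
        -log (∫ ω : EuclideanSpace ℝ ι, exp (-(∑ p ∈ S, ∑ x ∈ cell p, w x (ω x + φ x))) ∂(multivariateGaussian 0 Γ))) ψ) ψ₀
        (EuclideanSpace.single y (1 : ℝ))) (EuclideanSpace.single z (1 : ℝ))| ≤
      (4 * ((1 : ℝ) * ((Δ : ℝ) + 1) * (2 * (Real.exp (1 + η) *
        (((max (exp (v * (c₃ * h ^ 3 + 2 * c₂ * h ^ 2)) - 1) (2 * exp (-((κ / 2 - (κ₀ + 2 * c₂)) * h ^ 2)))) *
          exp (κ * (1 + τ⁻¹) * Ψ ^ 2 / 2)) * ((1 - θ) ^ (-(κ * (1 + τ) * γ / (2 * θ)))) ^ v)))) +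
        ((2 * c₂ ^ 2 * (δ₀ ^ 2)⁻¹ * M) + (c₂ * δ₀⁻¹ * M) ^ 2) + ((6 * c₂ ^ 3 * (δ₀ ^ 3)⁻¹ * M) + (c₂ * δ₀⁻¹ * M) * (2 * c₂ ^ 2 * (δ₀ ^ 2)⁻¹ * M) +
        2 * (2 * c₂ ^ 2 * (δ₀ ^ 2)⁻¹ * M) * (c₂ * δ₀⁻¹ * M) + 2 * (c₂ * δ₀⁻¹ * M) * (c₂ * δ₀⁻¹ * M) ^ 2) / 2) * exp (-(η * ((n : ℝ) + 1)) / 4) := by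
  -- the sites are distinct (their cells are)
  have hp : p₀ ≠ p₁ := fun h0 => by
    have := hd₁
    rw [← h0, hd₀] at this
    omega
  have hyz : y ≠ z := fun h0 => Finset.disjoint_left.1 (hdisj p₀ p₁ hp) hy (h0 ▸ hz)
  -- (320)'s letters: `δ := δ₀(1+τ)∕2`, `(2κ₀(1+τ) + 4δ)γ_op ≤ κ(1+τ)γ_op ≤ θ`
  have hδ : 0 < δ₀ * (1 + τ) / 2 := by positivity
  have hκθ' : (2 * κ₀ * (1 + τ) + 4 * (δ₀ * (1 + τ) / 2)) * γop ≤ θ :=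
    mul_opBound_le_of_le (a := 2 * κ₀ * (1 + τ) + 4 * (δ₀ * (1 + τ) / 2)) (b := κ * (1 + τ)) (by positivity)
      (by nlinarith [hτ.le, hc₂, hκ]) hθ0.le (by simpa [mul_assoc] using hκθ)
  have hw : ∀ x, Measurable (w x) := fun x => (continuous_iff_continuousAt.2 fun t => (hw' x t).continuousAt).measurable
  -- the Hessian is (319)'s form; (320) evaluates it at `e_y, e_z`
  rw [(hasFDerivAt_fderiv_neg_log_step hΓ hΓop hdisj hw' hw'' hw'm hw''m hκ₀ hκ₁ hτ hδ hθ0 hθ1 hκθ' hstab hw'b hw''b S ψ₀).fderiv,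
    hessian_neg_log_step_apply hΓ hΓop hdisj hw' hw'm hw''m hκ₀ hκ₁ hτ hδ hθ1 hκθ' hstab hw'b hw''b S ψ₀ (EuclideanSpace.single y (1 : ℝ)) (EuclideanSpace.single z (1 : ℝ))]
  -- the `w″` term vanishes, the gradient sums pick the sites
  have eAB : ∫ ω : EuclideanSpace ℝ ι, exp (-(∑ p ∈ S, ∑ x ∈ cell p, w x (ω x + ψ₀ x))) *
      (∑ p ∈ S, ∑ x ∈ cell p, w'' x (ω x + ψ₀ x) * (EuclideanSpace.single y (1 : ℝ)) x * (EuclideanSpace.single z (1 : ℝ)) x -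
        (∑ p ∈ S, ∑ x ∈ cell p, w' x (ω x + ψ₀ x) * (EuclideanSpace.single y (1 : ℝ)) x) *
          (∑ p ∈ S, ∑ x ∈ cell p, w' x (ω x + ψ₀ x) * (EuclideanSpace.single z (1 : ℝ)) x)) ∂(multivariateGaussian 0 Γ) =
      -(∫ ω : EuclideanSpace ℝ ι, exp (-(∑ p ∈ S, ∑ x ∈ cell p, w x (ω x + ψ₀ x))) * w' y (ω y + ψ₀ y) * w' z (ω z + ψ₀ z) ∂(multivariateGaussian 0 Γ)) := by
    rw [← integral_neg]
    refine integral_congr_ae (ae_of_all _ fun ω => ?_)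
    dsimp only
    rw [single_single_cellSum_eq_zero S hyz ω ψ₀, single_cellSum hdisj S hp₀ hy ω ψ₀, single_cellSum hdisj S hp₁ hz ω ψ₀]
    ring
  have eA : ∫ ω : EuclideanSpace ℝ ι, exp (-(∑ p ∈ S, ∑ x ∈ cell p, w x (ω x + ψ₀ x))) *
      (∑ p ∈ S, ∑ x ∈ cell p, w' x (ω x + ψ₀ x) * (EuclideanSpace.single y (1 : ℝ)) x) ∂(multivariateGaussian 0 Γ) = (∫ ω : EuclideanSpace ℝ ι, exp (-(∑ p ∈ S, ∑ x ∈ cell p, w x (ω x + ψ₀ x))) * w' y (ω y + ψ₀ y) ∂(multivariateGaussian 0 Γ)) :=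
    integral_congr_ae (ae_of_all _ fun ω => by
      dsimp only
      rw [single_cellSum hdisj S hp₀ hy ω ψ₀])
  have eB : ∫ ω : EuclideanSpace ℝ ι, exp (-(∑ p ∈ S, ∑ x ∈ cell p, w x (ω x + ψ₀ x))) *
      (∑ p ∈ S, ∑ x ∈ cell p, w' x (ω x + ψ₀ x) * (EuclideanSpace.single z (1 : ℝ)) x) ∂(multivariateGaussian 0 Γ) = (∫ ω : EuclideanSpace ℝ ι, exp (-(∑ p ∈ S, ∑ x ∈ cell p, w x (ω x + ψ₀ x))) * w' z (ω z + ψ₀ z) ∂(multivariateGaussian 0 Γ)) :=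
    integral_congr_ae (ae_of_all _ fun ω => by
      dsimp only
      rw [single_cellSum hdisj S hp₁ hz ω ψ₀])
  rw [eAB, eA, eB]
  -- `Z > 0`
  have hκθ₀ : 2 * κ₀ * (1 + τ) * γop ≤ θ :=
    mul_opBound_le_of_le (a := 2 * κ₀ * (1 + τ)) (b := κ * (1 + τ)) (by positivity) (by nlinarith [hτ.le, hc₂, hκ, hδ₀.le]) hθ0.le
      (by simpa [mul_assoc] using hκθ)
  have hZ : 0 < (∫ ω : EuclideanSpace ℝ ι, exp (-(∑ p ∈ S, ∑ x ∈ cell p, w x (ω x + ψ₀ x))) ∂(multivariateGaussian 0 Γ)) := by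
    have hI := integrable_exp_neg hΓ hΓop (S.biUnion cell) w hw hκ₀ hτ hθ1 hκθ₀ hstab (fun x => ψ₀ x)
    have hI' : Integrable (fun ω : EuclideanSpace ℝ ι => exp (-(∑ p ∈ S, ∑ x ∈ cell p, w x (ω x + ψ₀ x)))) (multivariateGaussian 0 Γ) :=
      hI.congr (ae_of_all _ fun ω => by simp only; rw [← cellSum_eq_sum_biUnion cell hdisj S])
    exact integral_exp_pos hI'
  rw [cov_rearrange hZ.ne', abs_neg]
  exact abs_tilted_cov_decay hΓ hΓop hdiag hγ hfr hdisj hv hR hΔ hnbr hw hw'm hw'm hκ₀ hc₂ hc₃ hh hδ₀ hstab hcub hw'q hw'q hκ hτ hθ0 hθ1 hκθ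
    hκθ₈ S ψ₀ hψ hp₀ hp₁ hy hz hd hd₀ hd₁ hη hsmall₂ hsmall hM

end Main

/-! ## §3. Toy -/

/-- Toy (§1): on two sites with the ZERO second derivative the `w″` term vanishes for `y = 0 ≠ 1 = z`. -/
example (ω ψ : EuclideanSpace ℝ (Fin 2)) :
    ∑ p ∈ ({()} : Finset Unit), ∑ x ∈ (fun _ : Unit => (Finset.univ : Finset (Fin 2))) p,
        (fun (_ : Fin 2) (_ : ℝ) => (0 : ℝ)) x (ω x + ψ x) * (EuclideanSpace.single (0 : Fin 2) (1 : ℝ)) x *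
          (EuclideanSpace.single (1 : Fin 2) (1 : ℝ)) x = 0 :=
  single_single_cellSum_eq_zero (cell := fun _ : Unit => Finset.univ) (w'' := fun _ _ => 0) {()} (by decide) ω ψ

end Summit.QuantumFields.BalabanUV.T4Continuum.NE7b.SupNextHessianLocality
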